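import Literature.Probability.RandomPlanarGeometry.SLEImageLocalisationTimes
import Literature.Probability.RandomPlanarGeometry.SLEImageDriverMeasurable
import Literature.Probability.RandomPlanarGeometry.SLEImageDriverIncrement
import Literature.Probability.Process.BrownianRunningSupFourthMoment
import HarnessLib

/-!
# The localised image driving process of SLE₆ under a `*`-hull: adaptedness and the boundary cell

Sequel of `SLEImageLocalisationPaths` / `SLEImageLocalisationTimes` ([LSW] 2003 §5; Lawler–Schramm–
Werner (2001) Thm. 2.2), preparing the conditional-increment proof that the stopped image driving
process `Mⁿ = imgMartK 6 hA hne n` is a martingale (`SLEImageLocalMartingale`). Theorems only: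

* `adapted_imgDrvP`, `stronglyAdapted_imgMartK`, `measurable_imgMartK`, `integrable_imgMartK`,
  `integrable_imgMartK_sq` — measurability (the constant term `L_{B_t}` is a random variable,
  `adapted_LFnK_brownianCPath` of `SLEImageDriverMeasurable`) and integrability (boundedness);
* `abs_imageDriver_sub_le_of_lt_imgLocTimeK` — **the boundary cell, pathwise**: from a base time
  `u < imgLocTimeK n` over a cell of length `h` on which the driver oscillates by at most `κ₀`, with
  `stepSize κ₀ h ≤ cₙ (cₙ/16)/1000`, the path stays alive and `|W̃_{u+u'} − W̃_u| ≤ 25h/ρ₀ + 2κ₀`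
  (`ρ₀ = cₙ/16`) for `0 < u' ≤ h` (`abs_imageDriver_add_sub_le` of `LoewnerImageFlow`); hence
  `abs_imgMartK_sub_sub_le`: on `{u < imgLocTimeK}` the defect
  `(Mⁿ_{u+h} − Mⁿ_u) − (imageDrvFnK_{u+h} − imageDrvFnK_u)` vanishes unless the localising time falls
  in `(u, u + h)`, where it is at most `50h/ρ₀ + 4κ₀`;
* `indicator_mul_le_add_pow_four`, `integral_indicator_oscFn_mul_runSup_le` — the tool bounding the
  (unbounded) defect on the bad event `{osc ≥ k}` of probability `O(h²)`: `𝟙_Bad X ≤ λ 𝟙_Bad + X⁴/λ³`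
  and the fourth moment of the running supremum (`integral_runSup_pow_four_le`).

## References

* [LSW] 2003, §5. [LawlerSchrammWerner2003Restriction]
* G. F. Lawler, O. Schramm, W. Werner, Acta Math. **187** (2001), Thm. 2.2. [LawlerSchrammWerner2001]
-/

noncomputable section

open Set Filter Metric Function MeasureTheory
open _root_.Complex _root_.Topology
open Literature.Probability.Process (brownian preWienerMeasure runSup)
open scoped NNReal

namespace Literature.Probability.RandomPlanarGeometry

open Loewner PathOps

/-! ### Adaptedness and integrability -/

section Adapted

variable {κ : ℝ≥0} {A : Set ℂ} {hA : IsStarHull A} {hne : A.Nonempty} {n : ℕ}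

/-- The tapered constant term along the Brownian path is adapted. [folklore] -/
theorem adapted_LhatFnK_brownianCPath (n : ℕ) :
    Adapted brownianFiltration fun t (ω : ℝ≥0 → ℝ) ↦ LhatFnK κ hA hne n t (brownianCPath ω) := fun t ↦ by
  simp only [LhatFnK_def]
  exact (adapted_LFnK_brownianCPath κ hA hne t).mul (measurable_const.min (measurable_const.mul (adapted_RpK (κ := κ) t)))

/-- **The image driving process (continuous modification) is adapted.** [folklore] -/
theorem adapted_imgDrvP (n : ℕ) : Adapted brownianFiltration (imgDrvP κ hA hne n) := fun t ↦ by
  have h0 : Measurable[brownianFiltration t] fun ω : ℝ≥0 → ℝ ↦ LhatFnK κ hA hne n 0 (brownianCPath ω) :=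
    (adapted_LhatFnK_brownianCPath (κ := κ) (hA := hA) (hne := hne) n 0).mono (brownianFiltration.mono bot_le) le_rfl
  have h1 : (imgDrvP κ hA hne n t) = fun ω ↦ drvK κ (brownianCPath ω) t + LhatFnK κ hA hne n 0 (brownianCPath ω) -
      LhatFnK κ hA hne n t (brownianCPath ω) := by
    funext ω; rw [imgDrvP_def, imgDrvFnK_def]
  rw [h1]
  exact ((measurable_drvK_brownianCPath_of_le le_rfl).add h0).sub (adapted_LhatFnK_brownianCPath n t)

/-- **`Mⁿ` is strongly adapted** (stopped continuous adapted process). [folklore] -/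
theorem stronglyAdapted_imgMartK (n : ℕ) : StronglyAdapted brownianFiltration (imgMartK κ hA hne n) :=
  (adapted_imgDrvP n).stronglyAdapted.stoppedProcess (continuous_imgDrvP n) (isStoppingTime_imgLocTimeK n)

/-- `Mⁿ_t` is measurable. [folklore] -/
theorem measurable_imgMartK (n : ℕ) (t : ℝ≥0) : Measurable (imgMartK κ hA hne n t) :=
  ((stronglyAdapted_imgMartK n) t).measurable.mono (brownianFiltration.le t) le_rfl

/-- `Mⁿ_t` is integrable (bounded). [folklore] -/
theorem integrable_imgMartK (n : ℕ) (t : ℝ≥0) : Integrable (imgMartK κ hA hne n t) preWienerMeasure := by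
  haveI := isProbabilityMeasure_preWienerMeasure'
  obtain ⟨N, -, hN⟩ := exists_forall_abs_imgMartK_le (κ := κ) hA hne n
  exact (integrable_const N).mono' (measurable_imgMartK n t).aestronglyMeasurable
    (Eventually.of_forall fun ω ↦ by rw [Real.norm_eq_abs]; exact hN t ω)

/-- `(Mⁿ_t)²` is integrable (bounded). [folklore] -/
theorem integrable_imgMartK_sq (n : ℕ) (t : ℝ≥0) : Integrable (fun ω ↦ imgMartK κ hA hne n t ω ^ 2) preWienerMeasure := by
  haveI := isProbabilityMeasure_preWienerMeasure'
  obtain ⟨N, -, hN⟩ := exists_forall_abs_imgMartK_le (κ := κ) hA hne n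
  refine (integrable_const (N ^ 2)).mono' ((measurable_imgMartK n t).pow_const 2).aestronglyMeasurable
    (Eventually.of_forall fun ω ↦ ?_)
  rw [Real.norm_eq_abs, abs_of_nonneg (sq_nonneg _), ← sq_abs]
  exact pow_le_pow_left₀ (abs_nonneg _) (hN t ω) 2

/-- The clock is measurable and integrable (`0 ≤ imgClockK t ≤ t`). [folklore] -/
theorem integrable_imgClockK (n : ℕ) (t : ℝ≥0) :
    Measurable (imgClockK κ hA hne n t) ∧ Integrable (imgClockK κ hA hne n t) preWienerMeasure := by
  haveI := isProbabilityMeasure_preWienerMeasure'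
  have hm : Measurable (imgClockK κ hA hne n t) := (adapted_imgClockK (κ := κ) (hA := hA) (hne := hne) n t).mono (brownianFiltration.le t) le_rfl
  exact ⟨hm, (integrable_const (t : ℝ)).mono' hm.aestronglyMeasurable (Eventually.of_forall fun ω ↦ by
    rw [Real.norm_eq_abs, abs_of_nonneg (imgClockK_nonneg n t ω)]; exact imgClockK_le n t ω)⟩

end Adapted

/-! ### The boundary cell, pathwise -/

section Boundary

variable {A : Set ℂ} {hA : IsStarHull A} {hne : A.Nonempty} {n : ℕ} {ω : ℝ≥0 → ℝ} {u h : ℝ≥0} {κ₀ : ℝ}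

/-- **One-step control of `W̃` from a base time `u < imgLocTimeK n` over a cell** on which the driver
oscillates by at most `κ₀`, with `stepSize κ₀ h ≤ cₙ (cₙ/16)/1000`: for `0 < u' ≤ h` the path is alive
at `u + u'` and `|W̃_{u+u'} − W̃_u| ≤ 25h/ρ₀ + 2κ₀`, `ρ₀ = cₙ/16` (`W̃ = Loewner.imageDriver`).
[cite: LawlerSchrammWerner2003Restriction, §5 (W̃ continuous)] -/
theorem abs_imageDriver_sub_le_of_lt_imgLocTimeK {κ : ℝ≥0} (hu : (u : WithTop ℝ≥0) < imgLocTimeK κ hA hne n ω)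
    (hS : ∀ r : ℝ≥0, r ≤ h → |drvK κ (brownianCPath ω) (u + r) - drvK κ (brownianCPath ω) u| ≤ κ₀)
    (hsmall : stepSize κ₀ h ≤ locLevel n * (locLevel n / 16) / 1000) {u' : ℝ≥0} (hu'0 : 0 < u') (hu'h : u' ≤ h) :
    Disjoint (closedHull (drvK κ (brownianCPath ω)) (u + u')) A ∧
      |imageDriver (drvK κ (brownianCPath ω)) A (u + u') - imageDriver (drvK κ (brownianCPath ω)) A u| ≤
        25 * h / (locLevel n / 16) + 2 * κ₀ := by
  obtain ⟨hc0, hc1⟩ := locLevel_pos_le n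
  set c := locLevel n with hc
  set ρ₀ : ℝ := c / 16 with hρ
  have hρ₀ : 0 < ρ₀ := by positivity
  set W := drvK κ (brownianCPath ω) with hW
  have hWc : Continuous W := continuous_drvK κ _
  obtain ⟨halive, -, -, hd, hm⟩ := controlled_of_lt_locTimeK (lt_of_lt_of_le hu (imgLocTimeK_le_locTimeK n ω))
  set B := slidHull W A u with hB
  have hBρ : Disjoint (ball (0 : ℂ) (8 * ρ₀)) B := by
    refine (disjoint_ball_infDist (x := (0 : ℂ)) (s := B)).mono_left (ball_subset_ball ?_)
    rw [hρ]; linarith [hm.le]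
  have hd1 := (starDeriv_pos_le_one B).2
  have hS0 : 0 ≤ κ₀ := by simpa using hS 0 bot_le
  -- smallness at radius `ρ₀`
  have hη : stepSize κ₀ h ≤ starDeriv B * ρ₀ / 1000 := by
    refine hsmall.trans ?_
    rw [div_le_div_iff_of_pos_right (by norm_num : (0:ℝ) < 1000)]
    exact mul_le_mul_of_nonneg_right hd.le hρ₀.le
  have hη' : stepSize κ₀ h ≤ ρ₀ / 1000 := hη.trans (by
    rw [div_le_div_iff_of_pos_right (by norm_num : (0:ℝ) < 1000)]; nlinarith)
  have hstep_mono : stepSize κ₀ u' ≤ stepSize κ₀ h := stepSize_mono κ₀ hu'h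
  have hη1 : stepSize κ₀ u' ≤ starDeriv B * ρ₀ / 1000 := hstep_mono.trans hη
  have hηρ : stepSize κ₀ u' ≤ ρ₀ := (hstep_mono.trans hη').trans (by linarith)
  have hh4' : (u' : ℝ) ≤ (ρ₀ / 4) ^ 2 := by
    have h1 : (u' : ℝ) ≤ h := by exact_mod_cast hu'h
    rw [stepSize] at hη'
    have hs := Real.sqrt_nonneg (h : ℝ)
    have h4 : Real.sqrt h ≤ ρ₀ / 4000 := by linarith
    have h5 : (h : ℝ) = Real.sqrt h ^ 2 := (Real.sq_sqrt h.coe_nonneg).symm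
    have h6 : Real.sqrt h ^ 2 ≤ (ρ₀ / 4000) ^ 2 := pow_le_pow_left₀ hs h4 2
    have h7 : (ρ₀ / 4000) ^ 2 ≤ (ρ₀ / 4) ^ 2 := by
      apply pow_le_pow_left₀ (by positivity)
      rw [div_le_div_iff₀ (by norm_num) (by norm_num)]; nlinarith
    linarith
  have hSu : ∀ r : ℝ≥0, r ≤ u' → |W (u + r) - W u| ≤ κ₀ := fun r hr ↦ hS r (hr.trans hu'h)
  refine ⟨disjoint_closedHull_add hWc hA halive hρ₀ hBρ hu'0 hSu hηρ hh4', ?_⟩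
  have key := abs_imageDriver_add_sub_le hWc hA halive hρ₀ hBρ hu'0 hSu hηρ hh4' hη1
  have hWu' : |W (u + u') - W u| ≤ κ₀ := hS u' hu'h
  have h25 : 25 * (u' : ℝ) / ρ₀ ≤ 25 * h / ρ₀ := by gcongr
  linarith

/-- **The defect of the cell decomposition, pathwise.** On `{u < imgLocTimeK n}`, with the driver
oscillating by at most `κ₀` over the cell and `stepSize κ₀ h ≤ cₙ (cₙ/16)/1000`:
`(Mⁿ_{u+h} − Mⁿ_u) − (imageDrvFnK_{u+h} − imageDrvFnK_u)` vanishes if `imgLocTimeK n ≥ u + h`, and is at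
most `50h/ρ₀ + 4κ₀` in absolute value otherwise. [folklore] -/
theorem abs_imgMartK_sub_sub_le {κ : ℝ≥0} (hu : (u : WithTop ℝ≥0) < imgLocTimeK κ hA hne n ω) (hh0 : 0 < h)
    (hS : ∀ r : ℝ≥0, r ≤ h → |drvK κ (brownianCPath ω) (u + r) - drvK κ (brownianCPath ω) u| ≤ κ₀)
    (hsmall : stepSize κ₀ h ≤ locLevel n * (locLevel n / 16) / 1000) :
    (((u + h : ℝ≥0) : WithTop ℝ≥0) ≤ imgLocTimeK κ hA hne n ω →
        (imgMartK κ hA hne n (u + h) ω - imgMartK κ hA hne n u ω) -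
          (imageDrvFnK κ A (u + h) (brownianCPath ω) - imageDrvFnK κ A u (brownianCPath ω)) = 0) ∧
      |(imgMartK κ hA hne n (u + h) ω - imgMartK κ hA hne n u ω) -
          (imageDrvFnK κ A (u + h) (brownianCPath ω) - imageDrvFnK κ A u (brownianCPath ω))| ≤
        50 * h / (locLevel n / 16) + 4 * κ₀ := by
  have h0 : (0 : WithTop ℝ≥0) < imgLocTimeK κ hA hne n ω := lt_of_le_of_lt bot_le hu
  have hMu : imgMartK κ hA hne n u ω = imageDrvFnK κ A u (brownianCPath ω) + (starShift A).re := by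
    rw [imgMartK_eq_of_le hu.le]; exact (imgDrvP_eq_of_le hu.le h0).2.1
  have hS0 : 0 ≤ κ₀ := by simpa using hS 0 bot_le
  have hD0 : 0 ≤ 50 * (h : ℝ) / (locLevel n / 16) + 4 * κ₀ := by
    have := (locLevel_pos_le n).1; positivity
  have hzero : (((u + h : ℝ≥0) : WithTop ℝ≥0) ≤ imgLocTimeK κ hA hne n ω) →
      (imgMartK κ hA hne n (u + h) ω - imgMartK κ hA hne n u ω) -
        (imageDrvFnK κ A (u + h) (brownianCPath ω) - imageDrvFnK κ A u (brownianCPath ω)) = 0 := fun hle ↦ by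
    rw [imgMartK_eq_of_le hle, (imgDrvP_eq_of_le hle h0).2.1, hMu]; ring
  refine ⟨hzero, ?_⟩
  rcases le_or_gt (((u + h : ℝ≥0) : WithTop ℝ≥0)) (imgLocTimeK κ hA hne n ω) with hle | hlt
  · rw [hzero hle, abs_zero]; exact hD0
  · -- the localising time `T₀ ∈ (u, u + h)`
    obtain ⟨T₀, hT₀⟩ := WithTop.ne_top_iff_exists.1 (imgLocTimeK_ne_top (κ := κ) (hA := hA) (hne := hne) n ω)
    have huT : u < T₀ := by have := hu; rw [← hT₀] at this; exact_mod_cast this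
    have hTuh : T₀ < u + h := by have := hlt; rw [← hT₀] at this; exact_mod_cast this
    set u' : ℝ≥0 := T₀ - u with hu'
    have hu'0 : 0 < u' := tsub_pos_of_lt huT
    have hTeq : T₀ = u + u' := by rw [hu', add_tsub_cancel_of_le huT.le]
    have hu'h : u' ≤ h := by
      have : u + u' ≤ u + h := by rw [← hTeq]; exact hTuh.le
      exact le_of_add_le_add_left this
    have hMT : imgMartK κ hA hne n (u + h) ω = imageDriver (drvK κ (brownianCPath ω)) A (u + u') := by
      rw [imgMartK_eq_of_ge hT₀.symm hTuh.le, hTeq]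
      exact (imgDrvP_eq_of_le (t := u + u') (by rw [← hTeq, hT₀]) h0).2.2
    have hMu' : imgMartK κ hA hne n u ω = imageDriver (drvK κ (brownianCPath ω)) A u := by
      rw [imgMartK_eq_of_le hu.le]; exact (imgDrvP_eq_of_le hu.le h0).2.2
    obtain ⟨-, e1⟩ := abs_imageDriver_sub_le_of_lt_imgLocTimeK hu hS hsmall hu'0 hu'h
    obtain ⟨halive, e2⟩ := abs_imageDriver_sub_le_of_lt_imgLocTimeK hu hS hsmall hh0 le_rfl
    have halive_u := (imgDrvP_eq_of_le hu.le h0).1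
    have hΦ : imageDrvFnK κ A (u + h) (brownianCPath ω) - imageDrvFnK κ A u (brownianCPath ω) =
        imageDriver (drvK κ (brownianCPath ω)) A (u + h) - imageDriver (drvK κ (brownianCPath ω)) A u := by
      rw [imageDrvFnK_of_alive halive, imageDrvFnK_of_alive halive_u, imageDriver, imageDriver]; ring
    rw [hMT, hMu', hΦ]
    calc _ ≤ |imageDriver (drvK κ (brownianCPath ω)) A (u + u') - imageDriver (drvK κ (brownianCPath ω)) A u| +
          |imageDriver (drvK κ (brownianCPath ω)) A (u + h) - imageDriver (drvK κ (brownianCPath ω)) A u| := abs_sub _ _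
      _ ≤ (25 * h / (locLevel n / 16) + 2 * κ₀) + (25 * h / (locLevel n / 16) + 2 * κ₀) := add_le_add e1 e2
      _ = _ := by ring

end Boundary

/-! ### The bad event: a fourth-moment tool -/

section Bad

/-- **`𝟙_E · X ≤ λ 𝟙_E + X⁴/λ³`** for `X ≥ 0`, `λ > 0` (if `X ≤ λ` the first term dominates, otherwise
`X ≤ X⁴/λ³`). [folklore] -/
theorem indicator_mul_le_add_pow_four {Ω : Type*} (E : Set Ω) {X : Ω → ℝ} (hX : ∀ ω, 0 ≤ X ω) {l : ℝ} (hl : 0 < l) (ω : Ω) :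
    E.indicator (fun _ ↦ (1 : ℝ)) ω * X ω ≤ l * E.indicator (fun _ ↦ (1 : ℝ)) ω + X ω ^ 4 / l ^ 3 := by
  have h4 : 0 ≤ X ω ^ 4 / l ^ 3 := by have := hX ω; positivity
  have hi : E.indicator (fun _ ↦ (1 : ℝ)) ω = 0 ∨ E.indicator (fun _ ↦ (1 : ℝ)) ω = 1 := by
    by_cases h : ω ∈ E
    · exact Or.inr (Set.indicator_of_mem h _)
    · exact Or.inl (Set.indicator_of_notMem h _)
  rcases hi with h | h
  · rw [h, zero_mul, mul_zero, zero_add]; exact h4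
  · rw [h, one_mul, mul_one]
    rcases le_or_gt (X ω) l with hle | hlt
    · linarith
    · have hX0 : 0 < X ω := hl.trans hlt
      have h3 : l ^ 3 ≤ X ω ^ 3 := pow_le_pow_left₀ hl.le hlt.le 3
      have : X ω ≤ X ω ^ 4 / l ^ 3 := by
        rw [le_div_iff₀ (pow_pos hl 3)]
        calc X ω * l ^ 3 ≤ X ω * X ω ^ 3 := mul_le_mul_of_nonneg_left h3 hX0.le
          _ = X ω ^ 4 := by ring
      linarith

variable [MeasurableSpace C(ℝ≥0, ℝ)] [BorelSpace C(ℝ≥0, ℝ)]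

/-- **Expectation of the running supremum on the bad event `{a ≤ osc_h(incr_u β)}`**: for `0 < a`,
`h ≤ (a/2)²/2` and `λ > 0`,
`E[𝟙_{a ≤ osc} · runSup (u+h)] ≤ λ · 128 h²/a⁴ + 18 (u+h)²/λ³` (tail of the oscillation and the fourth
moment of the running supremum). [folklore] -/
theorem integral_indicator_oscFn_mul_runSup_le (h u : ℝ≥0) {a : ℝ} (ha : 0 < a) (hh : (h : ℝ) ≤ (a / 2) ^ 2 / 2) {l : ℝ} (hl : 0 < l) :
    Integrable (fun ω ↦ {ω | a ≤ oscFn h (incr u (brownianCPath ω))}.indicator (fun _ ↦ (1 : ℝ)) ω * runSup (u + h) ω) preWienerMeasure ∧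
    ∫ ω, {ω | a ≤ oscFn h (incr u (brownianCPath ω))}.indicator (fun _ ↦ (1 : ℝ)) ω * runSup (u + h) ω ∂preWienerMeasure ≤
      l * (128 * (h : ℝ) ^ 2 / a ^ 4) + 18 * ((u + h : ℝ≥0) : ℝ) ^ 2 / l ^ 3 := by
  haveI := isProbabilityMeasure_preWienerMeasure'
  set E : Set (ℝ≥0 → ℝ) := {ω | a ≤ oscFn h (incr u (brownianCPath ω))} with hE
  have hEm : MeasurableSet E := measurableSet_le measurable_const ((measurable_oscFn h).comp ((measurable_incr u).comp measurable_brownianCPath))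
  have hIm : Measurable (E.indicator fun _ ↦ (1 : ℝ)) := measurable_const.indicator hEm
  have hX := Process.integrable_runSup_pow_four (u + h)
  have hI1 : Integrable (E.indicator fun _ ↦ (1 : ℝ)) preWienerMeasure := (integrable_const (1 : ℝ)).indicator hEm
  have hbound : ∀ ω, ‖E.indicator (fun _ ↦ (1 : ℝ)) ω * runSup (u + h) ω‖ ≤ l * E.indicator (fun _ ↦ (1 : ℝ)) ω + runSup (u + h) ω ^ 4 / l ^ 3 := by
    intro ω
    have h0 : 0 ≤ E.indicator (fun _ ↦ (1 : ℝ)) ω * runSup (u + h) ω :=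
      mul_nonneg (Set.indicator_nonneg (fun _ _ ↦ zero_le_one) ω) (Process.runSup_nonneg _ ω)
    rw [Real.norm_eq_abs, abs_of_nonneg h0]
    exact indicator_mul_le_add_pow_four E (fun ω ↦ Process.runSup_nonneg (u + h) ω) hl ω
  have hdom : Integrable (fun ω ↦ l * E.indicator (fun _ ↦ (1 : ℝ)) ω + runSup (u + h) ω ^ 4 / l ^ 3) preWienerMeasure :=
    (hI1.const_mul l).add (hX.div_const _)
  have hint : Integrable (fun ω ↦ E.indicator (fun _ ↦ (1 : ℝ)) ω * runSup (u + h) ω) preWienerMeasure :=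
    hdom.mono' (hIm.mul (Process.measurable_runSup (u + h))).aestronglyMeasurable (Eventually.of_forall hbound)
  refine ⟨hint, ?_⟩
  have hP : preWienerMeasure.real E ≤ 128 * (h : ℝ) ^ 2 / a ^ 4 := measureReal_oscFn_incr_ge_le h u ha hh
  calc ∫ ω, E.indicator (fun _ ↦ (1 : ℝ)) ω * runSup (u + h) ω ∂preWienerMeasure
      ≤ ∫ ω, (l * E.indicator (fun _ ↦ (1 : ℝ)) ω + runSup (u + h) ω ^ 4 / l ^ 3) ∂preWienerMeasure :=
        integral_mono hint hdom fun ω ↦ (le_abs_self _).trans (by have := hbound ω; rwa [Real.norm_eq_abs] at this)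
    _ = l * preWienerMeasure.real E + (∫ ω, runSup (u + h) ω ^ 4 ∂preWienerMeasure) / l ^ 3 := by
        rw [integral_add (hI1.const_mul l) (hX.div_const _), integral_const_mul, integral_indicator_const _ hEm,
          integral_div]
        simp
    _ ≤ l * (128 * (h : ℝ) ^ 2 / a ^ 4) + 18 * ((u + h : ℝ≥0) : ℝ) ^ 2 / l ^ 3 := by
        gcongr
        exact Process.integral_runSup_pow_four_le (u + h)

end Bad

end Literature.Probability.RandomPlanarGeometry

end
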